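import Mathlib.NumberTheory.LegendreSymbol.QuadraticReciprocity
import Mathlib.Data.ZMod.Basic
import Mathlib.RingTheory.PrincipalIdealDomain
import Mathlib.Data.Nat.Prime.Int
import Mathlib.Tactic.Ring
import Mathlib.Tactic.Linarith
import Mathlib.Tactic.NormNum
import Mathlib.Tactic.NormNum.Prime
import HarnessLib

/-!
# Venture HSemireg — two general non-norm obstructions behind the SIGN RULE and LAW A (ENGINE-W PROBE5 §16–§17): (1) if a prime
# `q ≡ 3 (mod 4)` divides `m`, then `ℤ[√m]` has NO element of norm `−1`; (2) if `ℓ ∥ D` and `k` is a non-residue mod `ℓ`, then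
# `x² + D·y² = k·z²` has only the zero solution (`k ∉ N(ℚ(√−D)^×)`) — kernel number theory

HONEST FRAMING. Lean index of the computation cell `pub-hsemireg`, widening group ENGINE-W (code A, seat `engine-w-1`, gen 17).
ELEMENTARY NUMBER THEORY (first supplement via Mathlib's `ZMod.exists_sq_eq_neg_one_iff`; an `ℓ`-adic descent); no abelian variety, sheaf,
`Ext` group, secant structure or semiregularity map is constructed; nothing here says that HC, HC_CM or HC_AV holds. Theorems only (0 `def`,
0 named fact, 0 `sorry`). New namespace `NonNorm`; generalises `SignRuleArithmetic.lean` §1 (the listed fields) and `SqrtMinusFiveNonNorms.lean`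
(`D = 5`, `k = 2, 3`).

SOURCE (the cell's own result): `widen/ENGINE-W/out/probe5/PROBE5-STIZ-A.md` §17 («`s(c) := sign N(z_c)` — well defined exactly when `k′` has no
unit of norm `−1` (`ℚ(√3), ℚ(√6), ℚ(√7), ℚ(√11), ℚ(√14), ℚ(√23), …`)») and §16 COROLLARY 1∕2 («every weight RATIO `c_i∕c_j` must lie in
`N(k′^×)` (LAW A)»; «`2, 3 ∉ N(ℚ(√−5)^×)` (5-adically)»). What the kernel holds:

* §1 **`no_norm_neg_one_of_prime_three_mod_four`** — `q` prime, `q % 4 = 3`, `q ∣ m` ⟹ `x² − m·y² ≠ −1` for all integers (`x² ≡ −1 (mod q)`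
  would make `−1` a square mod `q`); instances `m = 3, 6, 7, 11, 14, 19, 22, 23` via `q = 3, 3, 7, 11, 7, 19, 11, 23`.
* §2 **`only_zero_of_nonresidue`** — `ℓ` prime, `ℓ ∣ D`, `ℓ² ∤ D` (more precisely `¬ ℓ ∣ D∕ℓ`), `k` a non-residue mod `ℓ` (so `ℓ ∤ k`):
  `x² + D y² = k z²` ⟹ `x = y = z = 0` (descent on `|x|+|y|+|z|`); hence **`nonresidue_not_norm`**: no solution with `z ≠ 0`, i.e.
  `k ∉ N(ℚ(√−D)^×)`; instances `(D, ℓ, k) = (5, 5, 2), (5, 5, 3), (5, 5, 7), (6, 3, 2), (13, 13, 2)`.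
* §3 **`only_zero_of_ell_times_nonresidue`** — `x² + ℓy² = (ℓ·k′)z²` with `k′` a non-residue mod `ℓ` has only the zero solution (descent with
  `ℓ ∣ x` first); `five_times_nonresidue`: `10, 15, 35 ∉ N(ℚ(√−5)^×)`.
* §4 **`primitive_norm_not_dvd_four`** (`D ≡ 1 (mod 4)`: `x, y` not both even ⇒ `4 ∤ x² + Dy²`) and **`weight_pair_two_adic`** (`c` odd, `4 ∣ c′`,
  `c·n₁ = c′·n₂`, `4 ∤ n₁` ⇒ contradiction): no COROLLARY-1 datum `N(z)·c = N(z′)·c′` with `z` primitive exists for such weight pairs — with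
  §2–§3 this settles the NEVER column of OBSERVATION 16-4 (PROBE5 §16 v6.5) for `c < c′ ≤ 9`: LAW A kills `(1,2), (1,3), (1,7), (2,5), (2,9), (3,5),
  (5,7), (6,7), (7,9)` (`cc′ ∈ {2, 3, 7, 10, 18, 15, 35, 42, 63}` are non-norms: §2 for `2, 3, 7, 18, 42, 63` — non-residues mod 5 —, §3 for
  `10, 15, 35`), the 2-adic gap kills `(1,4), (1,8), (3,4), (3,8), (4,5), (4,7), (4,9), (5,8), (7,8), (8,9)` (`gap_pairs`).
-/

namespace Summit.Ventures.HSemireg.NonNorm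

/-! ## §1 No element of norm `−1` when a prime `≡ 3 (mod 4)` divides `m` -/

/-- **First-supplement obstruction**: if `q` is a prime with `q ≡ 3 (mod 4)` and `q ∣ m`, then `x² − m y² = −1` has no integer solution
(reducing mod `q` gives `x² = −1`, impossible by `ZMod.exists_sq_eq_neg_one_iff`). [kernel] -/
theorem no_norm_neg_one_of_prime_three_mod_four {q : ℕ} (hq : q.Prime) (hq3 : q % 4 = 3) {m : ℤ} (hqm : (q : ℤ) ∣ m)
    (x y : ℤ) : x ^ 2 - m * y ^ 2 ≠ -1 := by
  haveI : Fact q.Prime := ⟨hq⟩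
  intro h
  have hm0 : (m : ZMod q) = 0 := (ZMod.intCast_zmod_eq_zero_iff_dvd m q).2 hqm
  have hmod := congrArg (fun z : ℤ => (z : ZMod q)) h
  push_cast at hmod
  rw [hm0, zero_mul, sub_zero] at hmod
  have hsq : IsSquare (-1 : ZMod q) := ⟨(x : ZMod q), by rw [← hmod]; ring⟩
  exact (ZMod.exists_sq_eq_neg_one_iff.1 hsq) hq3

/-- **The fields of §17**: `ℤ[√m]` has no element of norm `−1` for `m = 3, 6, 7, 11, 14, 19, 22, 23` (witness primes `3, 3, 7, 11, 7, 19, 11, 23`,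
all `≡ 3 (mod 4)`). [kernel] -/
theorem sign_rule_fields (x y : ℤ) :
    x ^ 2 - 3 * y ^ 2 ≠ -1 ∧ x ^ 2 - 6 * y ^ 2 ≠ -1 ∧ x ^ 2 - 7 * y ^ 2 ≠ -1 ∧ x ^ 2 - 11 * y ^ 2 ≠ -1 ∧
    x ^ 2 - 14 * y ^ 2 ≠ -1 ∧ x ^ 2 - 19 * y ^ 2 ≠ -1 ∧ x ^ 2 - 22 * y ^ 2 ≠ -1 ∧ x ^ 2 - 23 * y ^ 2 ≠ -1 := by
  refine ⟨?_, ?_, ?_, ?_, ?_, ?_, ?_, ?_⟩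
  · exact no_norm_neg_one_of_prime_three_mod_four (q := 3) (by norm_num) (by norm_num) (by norm_num) x y
  · exact no_norm_neg_one_of_prime_three_mod_four (q := 3) (by norm_num) (by norm_num) (by norm_num) x y
  · exact no_norm_neg_one_of_prime_three_mod_four (q := 7) (by norm_num) (by norm_num) (by norm_num) x y
  · exact no_norm_neg_one_of_prime_three_mod_four (q := 11) (by norm_num) (by norm_num) (by norm_num) x y
  · exact no_norm_neg_one_of_prime_three_mod_four (q := 7) (by norm_num) (by norm_num) (by norm_num) x y
  · exact no_norm_neg_one_of_prime_three_mod_four (q := 19) (by norm_num) (by norm_num) (by norm_num) x y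
  · exact no_norm_neg_one_of_prime_three_mod_four (q := 11) (by norm_num) (by norm_num) (by norm_num) x y
  · exact no_norm_neg_one_of_prime_three_mod_four (q := 23) (by norm_num) (by norm_num) (by norm_num) x y

/-! ## §2 Non-residues are not norms: the `ℓ`-adic descent -/

/-- **The residue step**: `ℓ` prime, `ℓ ∣ D`, `k` not a square mod `ℓ` (in particular `ℓ ∤ k`); then `x² + D y² = k z²` forces `ℓ ∣ x` and `ℓ ∣ z`. [kernel] -/
theorem dvd_of_nonresidue {ℓ : ℕ} (hℓ : ℓ.Prime) {D k : ℤ} (hD : (ℓ : ℤ) ∣ D) (hk : ¬ IsSquare (k : ZMod ℓ))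
    {x y z : ℤ} (h : x ^ 2 + D * y ^ 2 = k * z ^ 2) : (ℓ : ℤ) ∣ x ∧ (ℓ : ℤ) ∣ z := by
  haveI : Fact ℓ.Prime := ⟨hℓ⟩
  have hD0 : (D : ZMod ℓ) = 0 := (ZMod.intCast_zmod_eq_zero_iff_dvd D ℓ).2 hD
  have hmod := congrArg (fun t : ℤ => (t : ZMod ℓ)) h
  push_cast at hmod
  rw [hD0, zero_mul, add_zero] at hmod
  -- if ℓ ∤ z then k = (x/z)² is a square mod ℓ
  have hz : (z : ZMod ℓ) = 0 := by
    by_contra hz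
    apply hk
    refine ⟨(x : ZMod ℓ) * (z : ZMod ℓ)⁻¹, ?_⟩
    have hzz : (z : ZMod ℓ) * (z : ZMod ℓ)⁻¹ = 1 := mul_inv_cancel₀ hz
    calc (k : ZMod ℓ) = (k : ZMod ℓ) * ((z : ZMod ℓ) * (z : ZMod ℓ)⁻¹) ^ 2 := by rw [hzz]; ring
      _ = ((k : ZMod ℓ) * (z : ZMod ℓ) ^ 2) * ((z : ZMod ℓ)⁻¹) ^ 2 := by ring
      _ = (x : ZMod ℓ) ^ 2 * ((z : ZMod ℓ)⁻¹) ^ 2 := by rw [← hmod]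
      _ = (x : ZMod ℓ) * (z : ZMod ℓ)⁻¹ * ((x : ZMod ℓ) * (z : ZMod ℓ)⁻¹) := by ring
  have hx : (x : ZMod ℓ) = 0 := by
    rw [hz] at hmod
    have : (x : ZMod ℓ) ^ 2 = 0 := by rw [hmod]; ring
    exact pow_eq_zero_iff (n := 2) (by norm_num) |>.1 this
  exact ⟨(ZMod.intCast_zmod_eq_zero_iff_dvd x ℓ).1 hx, (ZMod.intCast_zmod_eq_zero_iff_dvd z ℓ).1 hz⟩

/-- **One descent step**: with `D = ℓ·D′`, `ℓ ∤ D′`, a solution divisible by `ℓ` in `x` and `z` is divisible by `ℓ` in `y` too, and dividing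
through gives a solution again. [kernel] -/
theorem descend {ℓ : ℕ} (hℓ : ℓ.Prime) {D' k x₁ y z₁ : ℤ} (hD' : ¬ (ℓ : ℤ) ∣ D')
    (h : (ℓ * x₁) ^ 2 + (ℓ * D') * y ^ 2 = k * (ℓ * z₁) ^ 2) :
    ∃ y₁ : ℤ, y = ℓ * y₁ ∧ x₁ ^ 2 + (ℓ * D') * y₁ ^ 2 = k * z₁ ^ 2 := by
  have hℓZ : Prime (ℓ : ℤ) := Nat.prime_iff_prime_int.1 hℓ
  have hℓ0 : (ℓ : ℤ) ≠ 0 := by exact_mod_cast hℓ.ne_zero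
  -- ℓ·(D′ y²) = ℓ²(k z₁² − x₁²) ⇒ D′ y² = ℓ (k z₁² − x₁²) ⇒ ℓ ∣ y
  have h1 : D' * y ^ 2 = (ℓ : ℤ) * (k * z₁ ^ 2 - x₁ ^ 2) := by
    have h' : (ℓ : ℤ) * (D' * y ^ 2) = (ℓ : ℤ) * ((ℓ : ℤ) * (k * z₁ ^ 2 - x₁ ^ 2)) := by linear_combination h
    exact mul_left_cancel₀ hℓ0 h'
  have hy : (ℓ : ℤ) ∣ y := by
    have : (ℓ : ℤ) ∣ D' * y ^ 2 := ⟨_, h1⟩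
    rcases hℓZ.dvd_or_dvd this with hd | hy2
    · exact absurd hd hD'
    · exact hℓZ.dvd_of_dvd_pow hy2
  obtain ⟨y₁, rfl⟩ := hy
  refine ⟨y₁, rfl, ?_⟩
  have h' : (ℓ : ℤ) ^ 2 * (x₁ ^ 2 + (ℓ * D') * y₁ ^ 2) = (ℓ : ℤ) ^ 2 * (k * z₁ ^ 2) := by linear_combination h
  exact mul_left_cancel₀ (pow_ne_zero 2 hℓ0) h'

/-- **`k ∉ N(ℚ(√−D)^×)` for a non-residue `k`**: `ℓ` prime, `D = ℓ·D′` with `ℓ ∤ D′`, `k` a non-residue mod `ℓ`; then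
`x² + D y² = k z²` has only the zero solution. [kernel] -/
theorem only_zero_of_nonresidue {ℓ : ℕ} (hℓ : ℓ.Prime) {D' k : ℤ} (hD' : ¬ (ℓ : ℤ) ∣ D') (hk : ¬ IsSquare (k : ZMod ℓ)) :
    ∀ x y z : ℤ, x ^ 2 + (ℓ * D') * y ^ 2 = k * z ^ 2 → x = 0 ∧ y = 0 ∧ z = 0 := by
  have hℓ1 : 1 < ℓ := hℓ.one_lt
  suffices H : ∀ n : ℕ, ∀ x y z : ℤ, x.natAbs + y.natAbs + z.natAbs ≤ n →
      x ^ 2 + (ℓ * D') * y ^ 2 = k * z ^ 2 → x = 0 ∧ y = 0 ∧ z = 0 by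
    intro x y z h; exact H _ x y z le_rfl h
  intro n
  induction n using Nat.strong_induction_on with
  | _ n ih =>
    intro x y z hn h
    obtain ⟨⟨x₁, rfl⟩, ⟨z₁, rfl⟩⟩ := dvd_of_nonresidue hℓ (D := ℓ * D') (dvd_mul_right _ _) hk h
    obtain ⟨y₁, rfl, h'⟩ := descend hℓ hD' h
    by_cases h0 : x₁ = 0 ∧ y₁ = 0 ∧ z₁ = 0
    · obtain ⟨rfl, rfl, rfl⟩ := h0; simp
    · have hmeas : x₁.natAbs + y₁.natAbs + z₁.natAbs < n := by
        have e1 : ((ℓ : ℤ) * x₁).natAbs = ℓ * x₁.natAbs := by rw [Int.natAbs_mul, Int.natAbs_natCast]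
        have e2 : ((ℓ : ℤ) * y₁).natAbs = ℓ * y₁.natAbs := by rw [Int.natAbs_mul, Int.natAbs_natCast]
        have e3 : ((ℓ : ℤ) * z₁).natAbs = ℓ * z₁.natAbs := by rw [Int.natAbs_mul, Int.natAbs_natCast]
        rw [e1, e2, e3] at hn
        have hpos : 0 < x₁.natAbs + y₁.natAbs + z₁.natAbs := by
          by_contra hle
          push Not at hle
          have : x₁.natAbs = 0 ∧ y₁.natAbs = 0 ∧ z₁.natAbs = 0 := by omega
          exact h0 ⟨Int.natAbs_eq_zero.1 this.1, Int.natAbs_eq_zero.1 this.2.1, Int.natAbs_eq_zero.1 this.2.2⟩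
        nlinarith
      obtain ⟨hx, hy, hz⟩ := ih _ hmeas x₁ y₁ z₁ le_rfl h'
      exact absurd ⟨hx, hy, hz⟩ h0

/-- Consequently no solution has `z ≠ 0`: `k` is not the norm of an element of `ℚ(√−D)`. [kernel] -/
theorem nonresidue_not_norm {ℓ : ℕ} (hℓ : ℓ.Prime) {D' k : ℤ} (hD' : ¬ (ℓ : ℤ) ∣ D') (hk : ¬ IsSquare (k : ZMod ℓ))
    (x y z : ℤ) (hz : z ≠ 0) : x ^ 2 + (ℓ * D') * y ^ 2 ≠ k * z ^ 2 :=
  fun h => hz (only_zero_of_nonresidue hℓ hD' hk x y z h).2.2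

/-- **Instances**: `(D, ℓ, k) = (5, 5, 2), (5, 5, 3), (5, 5, 7)` (`ℚ(√−5)`: `2, 3, 7` are not norms — non-residues mod `5`), `(6, 3, 2)` (`ℚ(√−6)`: `2`
is not a norm), `(13, 13, 2)` (`ℚ(√−13)`: `2` is not a norm). [kernel] -/
theorem instances (x y z : ℤ) (hz : z ≠ 0) :
    x ^ 2 + 5 * y ^ 2 ≠ 2 * z ^ 2 ∧ x ^ 2 + 5 * y ^ 2 ≠ 3 * z ^ 2 ∧ x ^ 2 + 5 * y ^ 2 ≠ 7 * z ^ 2 ∧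
    x ^ 2 + 6 * y ^ 2 ≠ 2 * z ^ 2 ∧ x ^ 2 + 13 * y ^ 2 ≠ 2 * z ^ 2 := by
  have n5_2 : ¬ IsSquare ((2 : ℤ) : ZMod 5) := by decide
  have n5_3 : ¬ IsSquare ((3 : ℤ) : ZMod 5) := by decide
  have n5_7 : ¬ IsSquare ((7 : ℤ) : ZMod 5) := by decide
  have n3_2 : ¬ IsSquare ((2 : ℤ) : ZMod 3) := by decide
  have n13_2 : ¬ IsSquare ((2 : ℤ) : ZMod 13) := by decide
  refine ⟨?_, ?_, ?_, ?_, ?_⟩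
  · simpa using nonresidue_not_norm (ℓ := 5) (D' := 1) (k := 2) (by norm_num) (by decide) n5_2 x y z hz
  · simpa using nonresidue_not_norm (ℓ := 5) (D' := 1) (k := 3) (by norm_num) (by decide) n5_3 x y z hz
  · simpa using nonresidue_not_norm (ℓ := 5) (D' := 1) (k := 7) (by norm_num) (by decide) n5_7 x y z hz
  · simpa using nonresidue_not_norm (ℓ := 3) (D' := 2) (k := 2) (by norm_num) (by decide) n3_2 x y z hz
  · simpa using nonresidue_not_norm (ℓ := 13) (D' := 1) (k := 2) (by norm_num) (by decide) n13_2 x y z hz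

/-- More LAW A instances for OBSERVATION 16-4: `18, 42, 63 ∉ N(ℚ(√−5)^×)` (`≡ 3, 2, 3 (mod 5)`, non-residues). [kernel] -/
theorem instances_16_4 (x y z : ℤ) (hz : z ≠ 0) :
    x ^ 2 + 5 * y ^ 2 ≠ 18 * z ^ 2 ∧ x ^ 2 + 5 * y ^ 2 ≠ 42 * z ^ 2 ∧ x ^ 2 + 5 * y ^ 2 ≠ 63 * z ^ 2 := by
  have n18 : ¬ IsSquare ((18 : ℤ) : ZMod 5) := by decide
  have n42 : ¬ IsSquare ((42 : ℤ) : ZMod 5) := by decide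
  have n63 : ¬ IsSquare ((63 : ℤ) : ZMod 5) := by decide
  refine ⟨?_, ?_, ?_⟩
  · simpa using nonresidue_not_norm (ℓ := 5) (D' := 1) (k := 18) (by norm_num) (by decide) n18 x y z hz
  · simpa using nonresidue_not_norm (ℓ := 5) (D' := 1) (k := 42) (by norm_num) (by decide) n42 x y z hz
  · simpa using nonresidue_not_norm (ℓ := 5) (D' := 1) (k := 63) (by norm_num) (by decide) n63 x y z hz

/-! ## §3 `ℓ`-divisible non-norms: `x² + ℓ y² = (ℓ·k′) z²` with `k′` a non-residue (`10, 15, 35 ∉ N(ℚ(√−5)^×)`) -/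

/-- **`ℓ·k′` is not a norm from `ℚ(√−ℓ)` when `k′` is a non-residue mod `ℓ`**: `x² + ℓ y² = (ℓ k′) z²` has only the zero solution
(`ℓ ∣ x`; dividing, `ℓx₁² + y² = k′z²`; mod `ℓ`: `y² ≡ k′z²` forces `ℓ ∣ z` (else `k′` is a square), then `ℓ ∣ y`, and descent). [kernel] -/
theorem only_zero_of_ell_times_nonresidue {ℓ : ℕ} (hℓ : ℓ.Prime) {k' : ℤ} (hk : ¬ IsSquare (k' : ZMod ℓ)) :
    ∀ x y z : ℤ, x ^ 2 + (ℓ : ℤ) * y ^ 2 = ((ℓ : ℤ) * k') * z ^ 2 → x = 0 ∧ y = 0 ∧ z = 0 := by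
  haveI : Fact ℓ.Prime := ⟨hℓ⟩
  have hℓZ : Prime (ℓ : ℤ) := Nat.prime_iff_prime_int.1 hℓ
  have hℓ0 : (ℓ : ℤ) ≠ 0 := by exact_mod_cast hℓ.ne_zero
  have hℓ1 : 1 < ℓ := hℓ.one_lt
  suffices H : ∀ n : ℕ, ∀ x y z : ℤ, x.natAbs + y.natAbs + z.natAbs ≤ n →
      x ^ 2 + (ℓ : ℤ) * y ^ 2 = ((ℓ : ℤ) * k') * z ^ 2 → x = 0 ∧ y = 0 ∧ z = 0 by
    intro x y z h; exact H _ x y z le_rfl h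
  intro n
  induction n using Nat.strong_induction_on with
  | _ n ih =>
    intro x y z hn h
    -- ℓ ∣ x
    have hx : (ℓ : ℤ) ∣ x := hℓZ.dvd_of_dvd_pow (n := 2) ⟨k' * z ^ 2 - y ^ 2, by linear_combination h⟩
    obtain ⟨x₁, rfl⟩ := hx
    have h1 : (ℓ : ℤ) * x₁ ^ 2 + y ^ 2 = k' * z ^ 2 := by
      have h' : (ℓ : ℤ) * ((ℓ : ℤ) * x₁ ^ 2 + y ^ 2) = (ℓ : ℤ) * (k' * z ^ 2) := by linear_combination h
      exact mul_left_cancel₀ hℓ0 h'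
    have hmod := congrArg (fun t : ℤ => (t : ZMod ℓ)) h1
    push_cast at hmod
    rw [ZMod.natCast_self, zero_mul, zero_add] at hmod
    -- ℓ ∣ z (else k′ = (y/z)² is a square)
    have hz : (z : ZMod ℓ) = 0 := by
      by_contra hz
      apply hk
      refine ⟨(y : ZMod ℓ) * (z : ZMod ℓ)⁻¹, ?_⟩
      have hzz : (z : ZMod ℓ) * (z : ZMod ℓ)⁻¹ = 1 := mul_inv_cancel₀ hz
      calc (k' : ZMod ℓ) = (k' : ZMod ℓ) * ((z : ZMod ℓ) * (z : ZMod ℓ)⁻¹) ^ 2 := by rw [hzz]; ring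
        _ = ((k' : ZMod ℓ) * (z : ZMod ℓ) ^ 2) * ((z : ZMod ℓ)⁻¹) ^ 2 := by ring
        _ = (y : ZMod ℓ) ^ 2 * ((z : ZMod ℓ)⁻¹) ^ 2 := by rw [← hmod]
        _ = (y : ZMod ℓ) * (z : ZMod ℓ)⁻¹ * ((y : ZMod ℓ) * (z : ZMod ℓ)⁻¹) := by ring
    have hy : (y : ZMod ℓ) = 0 := by
      rw [hz] at hmod
      have : (y : ZMod ℓ) ^ 2 = 0 := by rw [hmod]; ring
      exact pow_eq_zero_iff (n := 2) (by norm_num) |>.1 this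
    obtain ⟨y₁, rfl⟩ := (ZMod.intCast_zmod_eq_zero_iff_dvd y ℓ).1 hy
    obtain ⟨z₁, rfl⟩ := (ZMod.intCast_zmod_eq_zero_iff_dvd z ℓ).1 hz
    -- divide by ℓ: x₁² + ℓ y₁² = (ℓ k′) z₁²
    have h' : x₁ ^ 2 + (ℓ : ℤ) * y₁ ^ 2 = ((ℓ : ℤ) * k') * z₁ ^ 2 := by
      have h'' : (ℓ : ℤ) * (x₁ ^ 2 + (ℓ : ℤ) * y₁ ^ 2) = (ℓ : ℤ) * (((ℓ : ℤ) * k') * z₁ ^ 2) := by linear_combination h1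
      exact mul_left_cancel₀ hℓ0 h''
    by_cases h0 : x₁ = 0 ∧ y₁ = 0 ∧ z₁ = 0
    · obtain ⟨rfl, rfl, rfl⟩ := h0; simp
    · have hmeas : x₁.natAbs + y₁.natAbs + z₁.natAbs < n := by
        have e1 : ((ℓ : ℤ) * x₁).natAbs = ℓ * x₁.natAbs := by rw [Int.natAbs_mul, Int.natAbs_natCast]
        have e2 : ((ℓ : ℤ) * y₁).natAbs = ℓ * y₁.natAbs := by rw [Int.natAbs_mul, Int.natAbs_natCast]
        have e3 : ((ℓ : ℤ) * z₁).natAbs = ℓ * z₁.natAbs := by rw [Int.natAbs_mul, Int.natAbs_natCast]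
        rw [e1, e2, e3] at hn
        have hpos : 0 < x₁.natAbs + y₁.natAbs + z₁.natAbs := by
          by_contra hle
          push Not at hle
          have : x₁.natAbs = 0 ∧ y₁.natAbs = 0 ∧ z₁.natAbs = 0 := by omega
          exact h0 ⟨Int.natAbs_eq_zero.1 this.1, Int.natAbs_eq_zero.1 this.2.1, Int.natAbs_eq_zero.1 this.2.2⟩
        nlinarith
      obtain ⟨hx', hy', hz'⟩ := ih _ hmeas x₁ y₁ z₁ le_rfl h'
      exact absurd ⟨hx', hy', hz'⟩ h0

/-- **`10, 15, 35 ∉ N(ℚ(√−5)^×)`** (`k′ = 2, 3, 7` non-residues mod `5`): no solution with `z ≠ 0`. [kernel] -/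
theorem five_times_nonresidue (x y z : ℤ) (hz : z ≠ 0) :
    x ^ 2 + 5 * y ^ 2 ≠ 10 * z ^ 2 ∧ x ^ 2 + 5 * y ^ 2 ≠ 15 * z ^ 2 ∧ x ^ 2 + 5 * y ^ 2 ≠ 35 * z ^ 2 := by
  have n2 : ¬ IsSquare ((2 : ℤ) : ZMod 5) := by decide
  have n3 : ¬ IsSquare ((3 : ℤ) : ZMod 5) := by decide
  have n7 : ¬ IsSquare ((7 : ℤ) : ZMod 5) := by decide
  refine ⟨fun h => hz ?_, fun h => hz ?_, fun h => hz ?_⟩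
  · exact (only_zero_of_ell_times_nonresidue (ℓ := 5) (by norm_num) n2 x y z (by simpa using h)).2.2
  · exact (only_zero_of_ell_times_nonresidue (ℓ := 5) (by norm_num) n3 x y z (by simpa using h)).2.2
  · exact (only_zero_of_ell_times_nonresidue (ℓ := 5) (by norm_num) n7 x y z (by simpa using h)).2.2

/-! ## §4 The 2-adic primitivity obstruction for weight pairs -/

/-- **Primitive norms are not divisible by 4** (`D ≡ 1 (mod 4)`, e.g. `D = 5`): if `x, y` are not both even then `4 ∤ x² + D y²`
(`x² + Dy² ≡ x² + y² (mod 4)`). [kernel] -/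
theorem primitive_norm_not_dvd_four (D x y : ℤ) (hD : D % 4 = 1) (hxy : ¬ ((2 : ℤ) ∣ x ∧ (2 : ℤ) ∣ y)) :
    ¬ (4 : ℤ) ∣ x ^ 2 + D * y ^ 2 := by
  intro h4
  obtain ⟨d, hd⟩ : ∃ d, D = 4 * d + 1 := ⟨D / 4, by omega⟩
  subst hd
  have key : ∀ a b e : ZMod 4, a ^ 2 + (4 * e + 1) * b ^ 2 = 0 → (a = 0 ∨ a = 2) ∧ (b = 0 ∨ b = 2) := by decide
  have hmod := (ZMod.intCast_zmod_eq_zero_iff_dvd (x ^ 2 + (4 * d + 1) * y ^ 2) 4).2 h4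
  push_cast at hmod
  obtain ⟨ha, hb⟩ := key _ _ _ hmod
  -- (t : ZMod 4) ∈ {0, 2} ⇒ 2 ∣ t
  have two_dvd : ∀ t : ℤ, ((t : ZMod 4) = 0 ∨ (t : ZMod 4) = 2) → (2 : ℤ) ∣ t := by
    intro t ht
    rcases ht with h0 | h2
    · exact dvd_trans (by norm_num) ((ZMod.intCast_zmod_eq_zero_iff_dvd t 4).1 h0)
    · have h2' : ((2 : ℤ) : ZMod 4) = (t : ZMod 4) := by rw [h2]; rfl
      have hdvd := (ZMod.intCast_eq_intCast_iff_dvd_sub 2 t 4).1 h2'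
      have : (2 : ℤ) ∣ t - 2 := dvd_trans (by norm_num) hdvd
      simpa using dvd_add this (dvd_refl 2)
  exact hxy ⟨two_dvd x ha, two_dvd y hb⟩

/-- **Weight pairs with a 2-adic gap**: if `c` is odd, `4 ∣ c′`, and `c·n₁ = c′·n₂` with `4 ∤ n₁`, contradiction — so no COROLLARY-1 datum
`N(z)·c = N(z′)·c′` exists with `z` primitive (by `primitive_norm_not_dvd_four`): the lines `(1,4), (1,8), (3,4), (3,8), (4,5), (4,7), (4,9),
(5,8), (7,8), (8,9)` of OBSERVATION 16-4 are NEVER reached by the `±√−5` seed. [kernel] -/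
theorem weight_pair_two_adic (c c' n₁ n₂ : ℤ) (hc : ¬ (2 : ℤ) ∣ c) (hc' : (4 : ℤ) ∣ c') (h : c * n₁ = c' * n₂)
    (hn₁ : ¬ (4 : ℤ) ∣ n₁) : False := by
  apply hn₁
  have h4 : (4 : ℤ) ∣ c * n₁ := by rw [h]; exact Dvd.dvd.mul_right hc' n₂
  -- gcd(c, 4) = 1 since c is odd
  have hcop : IsCoprime (4 : ℤ) c := by
    have : IsCoprime (2 : ℤ) c := (Irreducible.coprime_iff_not_dvd Int.prime_two.irreducible).2 hc
    have h22 : IsCoprime ((2 : ℤ) * 2) c := IsCoprime.mul_left this this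
    norm_num at h22; exact h22
  exact hcop.dvd_of_dvd_mul_left h4

/-- The ten gap pairs, as arithmetic facts: in each, one weight is odd and the other is divisible by `4`. [kernel, `decide`] -/
theorem gap_pairs :
    (¬ (2:ℤ) ∣ 1 ∧ (4:ℤ) ∣ 4) ∧ (¬ (2:ℤ) ∣ 1 ∧ (4:ℤ) ∣ 8) ∧ (¬ (2:ℤ) ∣ 3 ∧ (4:ℤ) ∣ 4) ∧ (¬ (2:ℤ) ∣ 3 ∧ (4:ℤ) ∣ 8) ∧
    (¬ (2:ℤ) ∣ 5 ∧ (4:ℤ) ∣ 4) ∧ (¬ (2:ℤ) ∣ 7 ∧ (4:ℤ) ∣ 4) ∧ (¬ (2:ℤ) ∣ 9 ∧ (4:ℤ) ∣ 4) ∧ (¬ (2:ℤ) ∣ 5 ∧ (4:ℤ) ∣ 8) ∧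
    (¬ (2:ℤ) ∣ 7 ∧ (4:ℤ) ∣ 8) ∧ (¬ (2:ℤ) ∣ 9 ∧ (4:ℤ) ∣ 8) := by
  decide

end Summit.Ventures.HSemireg.NonNorm
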